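import Summits.QuantumFields.YangMills.Theorems.FluctuationComparisonRegPrIntLS2BetaCoarseCurlRemainderCovariant
import Summits.QuantumFields.YangMills.Theorems.FluctuationComparisonRegPrIntLS2BetaCornerSizeCover
import HarnessLib

/-!
# S2β · (O3-R) «THE R-ROW AND ITS CLASS»: ONE explicit remainder row `R` that inhabits BOTH the c₁ knit's `hR` (✓p840244 `c1Budget_of_bkg_letters_volR`, via (β-3)′ C₇a
# ✓`norm_remainder_le_on_four_cov`) AND (V4)'s class letter `hRa` (✓p840010 `ER_le_beta_Sprime`: `R² ≤ acl(i+1)²·Σ_{corners}‖X i b‖²`) with an EXPLICIT class `acl`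

Cell `ym3-torus` (YM ladder rung R3 = continuum `SU(2)` Yang–Mills on the three-torus at fixed lattice data — a RUNG: NOT d = 4, NOT infinite volume, NOT
a mass gap, NOT Clay).  Width seat «width 20» `ym3-torus-px20` (gen 25), FREE px helper on crux `stmt-QuantumFields-20520`, LINE g18-1 S2β; pen (O3-R) named by
the desk (WORD №720, 2026-09-01T02:55:34Z; (O3-a) = the `ha` profile stays with px12∕px13).  `--kind proof --supports stmt-QuantumFields-20520 --as helper`,
count-neutral, DEFINITION-FREE (0 `def`, 0 `instance`, 0 `notation`, 0 `sorry`, default heartbeats); generic `P : Params` (`r + 1 ≤ m + K`), `SU(N)`, tower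
`U : (i : ℕ) → GaugeField P i (SU N)`, chart tower `X` (the station instantiates `U i := Ū^i U₀`, `N := 2`, `r := K − J`).  The long texts are generated by
script from C₇a∕(V4)'s binders (HOME `ym3-torus-px20/g25/gen_o3r_full.px20g25.py`).

THE CHOICE (per coarse plaquette `(y′; μ, ν)` at level `i+1`; `h` = C₇a's four-block axial gauge of `U i`, written out):
`Mc := max 0 (min (Mb i) (√(Σ_{b ∈ corners} ‖X i b‖²)))` (window sup ∧ ℓ²-corner size), `Oc := max 0 (min (Olev (i+1)) (2·Mc))`, `δc := max 0 (δ (i+1))`,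
`Aref κ := h(emb y′)·↑(X i ⟨emb y′, κ⟩)·h(emb y′)⋆` (the sandwich at the centre bond, a corner bond by `blockOf_emb`), and
`R μ ν (i+1) y′ := 8B·Oc²∕(a₀−Mc)² + 32B·Oc·Mc∕a₀² + (ℓMc)³ + 8·(67ℓ·((d−1)·3L·δc))·Mc²∕a₀²` (`B = 54ℓ(e^{a₀}−1)`, `ℓ = (d+2)L`) — C₇a's `R′` VERBATIM at `(Oc, Mc, δc)`,
as a `match i with | 0 => 0 | i'+1 => …` lambda (✓`cornerM_*` style); the clamps `max 0 ·` make `0 ≤ R` hold at EVERY level with letters asked only below `r`.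

WHAT IS PROVED (sorry-free).  ★`rprime_le_class_mul` (real algebra: `R′(Oc,Mc,δ) ≤ acl·Mc` from `Oc ≤ Olev`, `Oc ≤ 2Mc`, `0 ≤ Mc ≤ Mb`, `16Mb ≤ a₀`);
★★★**`exists_remainderRow_of_letters`**: from C₇a's windows VERBATIM (`ρr`, loop guards `α`, plaquette class `δ` with `PlaqSmall`, `a₀`), a LEVEL size letter
`hMb : ∀ i < r, ∀ b, ‖X i b‖ ≤ Mb i` with `16·Mb i ≤ a₀`, and the LEVEL covariant-oscillation letter
`hOSC : ∀ μ < ν, ∀ i < r, ∀ y′ b b′, corners → corners → b.dir = b′.dir → ‖h(b₋)·↑(X i b)·h(b₋)⋆ − h(b′₋)·↑(X i b′)·h(b′₋)⋆‖ ≤ Olev (i+1)` (✓C₇b `rows_K5_cov_osc`'s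
letter with a level constant = (REG-UP)′'s output shape): `∃ R, (∀ μ ν i x, 0 ≤ R μ ν i x) ∧ ⟨✓p840244's `hR` binder text⟩ ∧ ⟨✓p840010's `hRa` binder text⟩` with
**`acl (i+1) := 16B·Olev(i+1)∕(a₀ − Mb i)² + 32B·Olev(i+1)∕a₀² + ℓ³·(Mb i)² + 8·(67ℓ·((d−1)·3L·δ(i+1)))·Mb i∕a₀²`** (explicit `match` lambda in the statement).
`hR`: C₇a at `(Mc, Oc, Aref)` — `hXM` by `le_min` of the size letter and ✓`le_sqrt_sum_sq_of_mem`, `hXO` by `le_min` of `hOSC` at `b′ := ⟨emb y′, b.dir⟩` and the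
triangle `‖hX_bh⋆‖ + ‖Aref‖ ≤ 2Mc` (✓`norm_coe_conj_le`), windows `8Mc ≤ a₀`, `8Oc ≤ 16Mc ≤ a₀`.  `hRa` needs NO oscillation letter (`Oc ≤ Olev ∧ Oc ≤ 2Mc`).
FOR (O3-a) (px12∕px13): `ha : acl(i+1)² ≤ A²·(L^{2i}∕L^{2(K−J)})²` reads off `Olev(i+1) ∝ L^{2i}η²` ((REG-UP)′), `(Mb i)² ∝ L^{2i}η²` ((C-M)), `δ(i+1)·Mb i ∝ L^{2i}η²` ((BKG)).

HONEST SCOPE.  Two `min`∕`max` clamps, C₇a by name, triangle inequalities and real algebra; nothing of Bałaban's renormalisation-group analysis is asserted or proved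
([Balaban1985Averaging] pp.24–25, Prop. 3 (121)–(125) p.36, Prop. 4 (128)–(135) pp.37–38 are the printed loci C₇a transcribes); `Mb`, `Olev`, `δ`, `α`, the windows
are HYPOTHESES ((C-M), (REG-UP)′, (BKG) business); (O3-a), GAP♯∘ (`stub_uniformFibreGapOrbit`, registry 3732b7df UNTOUCHED, 0∕5), the five registered stubs, S2β, crux
20520, 19936, 19200 and `YM3TorusSU2` are NOT proved; no registered stub is closed; rung R3 — NOT d = 4, NOT infinite volume, NOT a mass gap, NOT Clay; the Yang–Mills
mass gap is NOT proved.
-/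

set_option autoImplicit false

noncomputable section

open scoped Matrix.Norms.L2Operator
open Finset

namespace Summit.QuantumFields.YangMills.Theorems.FluctuationComparisonRegPrIntLS2BetaRemainderRowClass

open Literature.MathematicalPhysics.QuantumFieldTheory.Balaban1983to89
open Literature.MathematicalPhysics.QuantumFieldTheory.Balaban1983to89.HaarExponentialChart
open Literature.MathematicalPhysics.QuantumFieldTheory.Balaban1983to89.HaarExponentialChart.IsChartRep
open Literature.MathematicalPhysics.QuantumFieldTheory.Balaban1983to89.BlockAveraging (Idx avgFun loopHol)
open Literature.MathematicalPhysics.QuantumFieldTheory.Balaban1983to89.ExpMeanLog (expMeanLogSU deltaSU)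
open Literature.MathematicalPhysics.QuantumFieldTheory.Balaban1983to89.Node00
open Summit.QuantumFields.YangMills.Theorems.FluctuationComparisonRegPrIntLS2BetaChartReadGaugeCovariance (conj_mem_lie)
open Summit.QuantumFields.YangMills.Theorems.FluctuationComparisonRegPrIntLS2BetaCovWalkSumStokes (norm_coe_conj_le)
open Summit.QuantumFields.YangMills.Theorems.FluctuationComparisonRegPrIntLS2BetaCoarseCurlRemainderCovariant (norm_remainder_le_on_four_cov)
open Summit.QuantumFields.YangMills.Theorems.FluctuationComparisonRegPrIntLS2BetaCornerSizeCover (le_sqrt_sum_sq_of_mem)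

variable {P : Params} {N : ℕ} [NeZero N]

omit [NeZero N] in
/-- Real algebra: the class bound `R′(Oc, Mc, δ) ≤ acl·Mc` term by term (`Oc ≤ Olev`, `Oc ≤ 2Mc`, `Mc ≤ Mb`, `16·Mb ≤ a₀`). [folklore] -/
theorem rprime_le_class_mul {B ℓ D a₀ Oc Mc Mb Olev δv : ℝ} (hB : 0 ≤ B) (hℓ : 0 ≤ ℓ) (hD : 0 ≤ D) (ha0 : 0 < a₀)
    (hMc0 : 0 ≤ Mc) (hMcMb : Mc ≤ Mb) (hMb16 : 16 * Mb ≤ a₀) (hδ : 0 ≤ δv)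
    (hOc0 : 0 ≤ Oc) (hOcO : Oc ≤ Olev) (hOc2 : Oc ≤ 2 * Mc) :
    8 * B * Oc ^ 2 / (a₀ - Mc) ^ 2 + 32 * B * Oc * Mc / a₀ ^ 2 + (ℓ * Mc) ^ 3 + 8 * (67 * (ℓ * (D * δv))) * Mc ^ 2 / a₀ ^ 2 ≤
      (16 * B * Olev / (a₀ - Mb) ^ 2 + 32 * B * Olev / a₀ ^ 2 + ℓ ^ 3 * Mb ^ 2 + 8 * (67 * (ℓ * (D * δv))) * Mb / a₀ ^ 2) * Mc := by
  have hMb0 : 0 ≤ Mb := hMc0.trans hMcMb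
  have hO0 : 0 ≤ Olev := hOc0.trans hOcO
  have hden : 0 < a₀ - Mb := by linarith
  have hden' : 0 < a₀ - Mc := by linarith
  have ha2 : 0 < a₀ ^ 2 := by positivity
  -- term 1
  have h1 : 8 * B * Oc ^ 2 / (a₀ - Mc) ^ 2 ≤ 16 * B * Olev / (a₀ - Mb) ^ 2 * Mc := by
    have hOc2' : Oc ^ 2 ≤ Olev * (2 * Mc) := by nlinarith
    have hsq' : (a₀ - Mb) ^ 2 ≤ (a₀ - Mc) ^ 2 := by nlinarith
    calc 8 * B * Oc ^ 2 / (a₀ - Mc) ^ 2 ≤ 8 * B * (Olev * (2 * Mc)) / (a₀ - Mc) ^ 2 := by gcongr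
      _ ≤ 8 * B * (Olev * (2 * Mc)) / (a₀ - Mb) ^ 2 :=
          div_le_div_of_nonneg_left (by positivity) (by positivity) hsq'
      _ = 16 * B * Olev / (a₀ - Mb) ^ 2 * Mc := by ring
  -- term 2
  have h2 : 32 * B * Oc * Mc / a₀ ^ 2 ≤ 32 * B * Olev / a₀ ^ 2 * Mc := by
    rw [div_mul_eq_mul_div]
    exact div_le_div_of_nonneg_right (by nlinarith [mul_nonneg hB hMc0]) ha2.le
  -- term 3
  have h3 : (ℓ * Mc) ^ 3 ≤ ℓ ^ 3 * Mb ^ 2 * Mc := by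
    have hMc2 : Mc ^ 2 ≤ Mb ^ 2 := by nlinarith
    have hl3 : 0 ≤ ℓ ^ 3 := pow_nonneg hℓ 3
    calc (ℓ * Mc) ^ 3 = ℓ ^ 3 * Mc ^ 2 * Mc := by ring
      _ ≤ ℓ ^ 3 * Mb ^ 2 * Mc := by gcongr
  -- term 4
  have h4 : 8 * (67 * (ℓ * (D * δv))) * Mc ^ 2 / a₀ ^ 2 ≤ 8 * (67 * (ℓ * (D * δv))) * Mb / a₀ ^ 2 * Mc := by
    rw [div_mul_eq_mul_div]
    refine div_le_div_of_nonneg_right ?_ ha2.le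
    have hc : 0 ≤ 8 * (67 * (ℓ * (D * δv))) := by positivity
    calc 8 * (67 * (ℓ * (D * δv))) * Mc ^ 2 = 8 * (67 * (ℓ * (D * δv))) * Mc * Mc := by ring
      _ ≤ 8 * (67 * (ℓ * (D * δv))) * Mb * Mc := by gcongr
  calc _ ≤ 16 * B * Olev / (a₀ - Mb) ^ 2 * Mc + 32 * B * Olev / a₀ ^ 2 * Mc + ℓ ^ 3 * Mb ^ 2 * Mc + 8 * (67 * (ℓ * (D * δv))) * Mb / a₀ ^ 2 * Mc := by
        linarith
    _ = _ := by ring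

/-- ★★★ **(O3-R) THE R-ROW AND ITS CLASS** — see the module header. [cite: Balaban1985Averaging, p.19, pp.24-25, Prop. 3 (121)-(125) p.36, Prop. 4 (128)-(135) pp.37-38; Balaban1987RG1, (0.3)-(0.4) pp.252-253] -/
theorem exists_remainderRow_of_letters (r : ℕ) (hr2 : r + 1 ≤ P.m + P.K)
    (U : (i : ℕ) → GaugeField P i (SU N)) (X : (i : ℕ) → PBond P i → (specialUnitaryLogChart (Fin N)).lie)
    {ρr : ℝ} (hρ0 : 0 < ρr) (hρr : ρr ≤ innerRadius (specialUnitaryLogChart (Fin N)))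
    (α δ : ℕ → ℝ)
    (hα : ∀ i, i < r → ∀ (c : PBond P (i + 1)) (ι : Idx P), dist1 (loopHol (U i) c ι) ≤ α (i + 1))
    (hα4 : ∀ i, i < r → 4 * α (i + 1) ≤ ρr)
    (hδ : ∀ i, i < r → 0 ≤ δ (i + 1)) (hUs : ∀ i, i < r → PlaqSmall (δ (i + 1)) (U i))
    (hδℓ : ∀ i, i < r → 100 * ((((P.d + 2) * P.L : ℕ) : ℝ) * (((P.d - 1 : ℕ) : ℝ) * ((3 * P.L : ℕ) : ℝ) * δ (i + 1))) ≤ ρr)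
    {a₀ : ℝ} (ha0 : 0 < a₀) (ha : 100 * ((((P.d + 2) * P.L : ℕ) : ℝ) * (Real.exp a₀ - 1)) ≤ ρr)
    (Mb : ℕ → ℝ) (hMb0 : ∀ i, i < r → 0 ≤ Mb i) (hMb : ∀ i, i < r → ∀ b : PBond P i, ‖X i b‖ ≤ Mb i) (hMb16 : ∀ i, i < r → 16 * Mb i ≤ a₀)
    (Olev : ℕ → ℝ) (hO0 : ∀ i, i < r → 0 ≤ Olev (i + 1))
    (hOSC : ∀ μ ν : Fin P.d, μ < ν → ∀ i, i < r → ∀ (y' : Site P (i + 1)) (b b' : PBond P i), (blockOf b.src = y' ∨ blockOf b.src = y'.shift μ ∨ blockOf b.src = y'.shift ν ∨ blockOf b.src = (y'.shift μ).shift ν) → (blockOf b'.src = y' ∨ blockOf b'.src = y'.shift μ ∨ blockOf b'.src = y'.shift ν ∨ blockOf b'.src = (y'.shift μ).shift ν) → b.dir = b'.dir →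
      ‖(((T4AxialGaugeSmallField.axialGauge (U i) (fun κ : Fin P.d => (((emb y' κ).val : ℕ) : ℤ) - (((P.L - 1) / 2 : ℕ) : ℤ)) (fun κ : Fin P.d => (((emb y' κ).val : ℕ) : ℤ) + (((if κ = μ then (P.L : ℤ) else 0) + (if κ = ν then (P.L : ℤ) else 0)) + (((P.L - 1) / 2 : ℕ) : ℤ)) + 1)) b.src : SU N) : Matrix (Fin N) (Fin N) ℂ) * ((X i b : (specialUnitaryLogChart (Fin N)).lie) : Matrix (Fin N) (Fin N) ℂ) * star (((T4AxialGaugeSmallField.axialGauge (U i) (fun κ : Fin P.d => (((emb y' κ).val : ℕ) : ℤ) - (((P.L - 1) / 2 : ℕ) : ℤ)) (fun κ : Fin P.d => (((emb y' κ).val : ℕ) : ℤ) + (((if κ = μ then (P.L : ℤ) else 0) + (if κ = ν then (P.L : ℤ) else 0)) + (((P.L - 1) / 2 : ℕ) : ℤ)) + 1)) b.src : SU N) : Matrix (Fin N) (Fin N) ℂ) -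
        ((((T4AxialGaugeSmallField.axialGauge (U i) (fun κ : Fin P.d => (((emb y' κ).val : ℕ) : ℤ) - (((P.L - 1) / 2 : ℕ) : ℤ)) (fun κ : Fin P.d => (((emb y' κ).val : ℕ) : ℤ) + (((if κ = μ then (P.L : ℤ) else 0) + (if κ = ν then (P.L : ℤ) else 0)) + (((P.L - 1) / 2 : ℕ) : ℤ)) + 1)) b'.src : SU N) : Matrix (Fin N) (Fin N) ℂ) * ((X i b' : (specialUnitaryLogChart (Fin N)).lie) : Matrix (Fin N) (Fin N) ℂ) * star (((T4AxialGaugeSmallField.axialGauge (U i) (fun κ : Fin P.d => (((emb y' κ).val : ℕ) : ℤ) - (((P.L - 1) / 2 : ℕ) : ℤ)) (fun κ : Fin P.d => (((emb y' κ).val : ℕ) : ℤ) + (((if κ = μ then (P.L : ℤ) else 0) + (if κ = ν then (P.L : ℤ) else 0)) + (((P.L - 1) / 2 : ℕ) : ℤ)) + 1)) b'.src : SU N) : Matrix (Fin N) (Fin N) ℂ))‖ ≤ Olev (i + 1)) :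
    ∃ R : Fin P.d → Fin P.d → (i : ℕ) → Site P i → ℝ,
      (∀ μ ν i x, 0 ≤ R μ ν i x) ∧
      (∀ μ ν : Fin P.d, μ < ν → ∀ i, i < r → ∀ (y' : Site P (i + 1)) (c : PBond P (i + 1)), (c = ⟨y', μ⟩ ∨ c = ⟨y'.shift μ, ν⟩ ∨ c = ⟨y'.shift ν, μ⟩ ∨ c = ⟨y', ν⟩) →
        ‖(((isChartRep_specialUnitaryGroup (n := Fin N)).logChart (avgFun (expMeanLogSU (n := Fin N)) (fun b => (isChartRep_specialUnitaryGroup (n := Fin N)).expChart (X i b) * U i b) c * (avgFun (expMeanLogSU (n := Fin N)) (U i) c)⁻¹) : (specialUnitaryLogChart (Fin N)).lie) : Matrix (Fin N) (Fin N) ℂ) -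
        ((fderiv ℝ (fun (A : PBond P i → (specialUnitaryLogChart (Fin N)).lie) (c : PBond P (i + 1)) => (isChartRep_specialUnitaryGroup (n := Fin N)).logChart (avgFun (expMeanLogSU (n := Fin N)) (fun b => (isChartRep_specialUnitaryGroup (n := Fin N)).expChart (A b) * U i b) c * (avgFun (expMeanLogSU (n := Fin N)) (U i) c)⁻¹)) 0 (X i) c : (specialUnitaryLogChart (Fin N)).lie) : Matrix (Fin N) (Fin N) ℂ)‖ ≤ R μ ν (i + 1) y') ∧
      (∀ (μ ν : Fin P.d) (i : ℕ), i < r → ∀ y' : Site P (i + 1),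
        R μ ν (i + 1) y' ^ 2 ≤ (fun (i : ℕ) => match i with
      | 0 => (0 : ℝ)
      | i' + 1 => 16 * (54 * ((((P.d + 2) * P.L : ℕ) : ℝ) * (Real.exp a₀ - 1))) * Olev (i' + 1) / (a₀ - Mb i') ^ 2 + 32 * (54 * ((((P.d + 2) * P.L : ℕ) : ℝ) * (Real.exp a₀ - 1))) * Olev (i' + 1) / a₀ ^ 2 +
          (((P.d + 2) * P.L : ℕ) : ℝ) ^ 3 * (Mb i') ^ 2 + 8 * (67 * ((((P.d + 2) * P.L : ℕ) : ℝ) * (((P.d - 1 : ℕ) : ℝ) * ((3 * P.L : ℕ) : ℝ) * δ (i' + 1)))) * Mb i' / a₀ ^ 2 : ℕ → ℝ) (i + 1) ^ 2 * ∑ b ∈ (univ.filter (fun b : PBond P i => blockOf b.src = y' ∨ blockOf b.src = y'.shift μ ∨ blockOf b.src = y'.shift ν ∨ blockOf b.src = (y'.shift μ).shift ν)), ‖X i b‖ ^ 2) := by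
  classical
  have hB0 : 0 ≤ (54 * ((((P.d + 2) * P.L : ℕ) : ℝ) * (Real.exp a₀ - 1))) := by
    have : 0 ≤ Real.exp a₀ - 1 := by linarith [Real.add_one_le_exp a₀]
    positivity
  refine ⟨(fun (μ ν : Fin P.d) (i : ℕ) =>
      match i with
      | 0 => fun (_ : Site P 0) => (0 : ℝ)
      | i' + 1 => fun (y' : Site P (i' + 1)) =>
        8 * (54 * ((((P.d + 2) * P.L : ℕ) : ℝ) * (Real.exp a₀ - 1))) * (max 0 (min (Olev (i' + 1)) (2 * (max 0 (min (Mb i') (Real.sqrt (∑ b ∈ (univ.filter (fun b : PBond P i' => blockOf b.src = y' ∨ blockOf b.src = y'.shift μ ∨ blockOf b.src = y'.shift ν ∨ blockOf b.src = (y'.shift μ).shift ν)), ‖X i' b‖ ^ 2))))))) ^ 2 / (a₀ - (max 0 (min (Mb i') (Real.sqrt (∑ b ∈ (univ.filter (fun b : PBond P i' => blockOf b.src = y' ∨ blockOf b.src = y'.shift μ ∨ blockOf b.src = y'.shift ν ∨ blockOf b.src = (y'.shift μ).shift ν)), ‖X i' b‖ ^ 2))))) ^ 2 + 32 * (54 *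 ((((P.d + 2) * P.L : ℕ) : ℝ) * (Real.exp a₀ - 1))) * (max 0 (min (Olev (i' + 1)) (2 * (max 0 (min (Mb i') (Real.sqrt (∑ b ∈ (univ.filter (fun b : PBond P i' => blockOf b.src = y' ∨ blockOf b.src = y'.shift μ ∨ blockOf b.src = y'.shift ν ∨ blockOf b.src = (y'.shift μ).shift ν)), ‖X i' b‖ ^ 2))))))) * (max 0 (min (Mb i') (Real.sqrt (∑ b ∈ (univ.filter (fun b : PBond P i' => blockOf b.src = y' ∨ blockOf b.src = y'.shift μ ∨ blockOf b.src = y'.shift ν ∨ blockOf b.src = (y'.shift μ).shift ν)), ‖X i' b‖ ^ 2)))) / a₀ ^ 2 + ((((P.d + 2) * P.L : ℕ) : ℝ) * (max 0 (min (Mb i') (Real.sqrt (∑ b ∈ (univ.filter (fun b : PBond P i' => blockOf b.src = y' ∨ blockOf b.src = y'.shift μ ∨ blockOf b.src = y'.shift ν ∨ blockOf b.src = (y'.shift μ).shift ν)), ‖X i' b‖ ^ 2))))) ^ 3 + 8 * (67 * ((((P.d + 2) * P.L : ℕ) : ℝ) * (((P.d - 1 : ℕ) : ℝ) * ((3 *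 P.L : ℕ) : ℝ) * (max 0 (δ (i' + 1)))))) * (max 0 (min (Mb i') (Real.sqrt (∑ b ∈ (univ.filter (fun b : PBond P i' => blockOf b.src = y' ∨ blockOf b.src = y'.shift μ ∨ blockOf b.src = y'.shift ν ∨ blockOf b.src = (y'.shift μ).shift ν)), ‖X i' b‖ ^ 2)))) ^ 2 / a₀ ^ 2
      : Fin P.d → Fin P.d → (i : ℕ) → Site P i → ℝ), ?_, ?_, ?_⟩
  · -- (hR0) every term is nonnegative at every level
    intro μ ν i x
    cases i with
    | zero => exact le_rfl
    | succ i' =>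
      show (0 : ℝ) ≤ 8 * (54 * ((((P.d + 2) * P.L : ℕ) : ℝ) * (Real.exp a₀ - 1))) * (max 0 (min (Olev (i' + 1)) (2 * (max 0 (min (Mb i') (Real.sqrt (∑ b ∈ (univ.filter (fun b : PBond P i' => blockOf b.src = x ∨ blockOf b.src = x.shift μ ∨ blockOf b.src = x.shift ν ∨ blockOf b.src = (x.shift μ).shift ν)), ‖X i' b‖ ^ 2))))))) ^ 2 / (a₀ - (max 0 (min (Mb i') (Real.sqrt (∑ b ∈ (univ.filter (fun b : PBond P i' => blockOf b.src = x ∨ blockOf b.src = x.shift μ ∨ blockOf b.src = x.shift ν ∨ blockOf b.src = (x.shift μ).shift ν)), ‖X i' b‖ ^ 2))))) ^ 2 + 32 * (54 * ((((P.d + 2) * P.L : ℕ) : ℝ) * (Real.exp a₀ - 1))) * (max 0 (min (Olev (i' + 1)) (2 * (max 0 (min (Mb i') (Real.sqrt (∑ b ∈ (univ.filter (fun b : PBond P i' => blockOf b.src = x ∨ blockOf b.src = x.shift μ ∨ blockOf b.src = x.shift ν ∨ blockOf b.src = (x.shift μ).shift ν)), ‖X i' b‖ ^ 2))))))) * (max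 0 (min (Mb i') (Real.sqrt (∑ b ∈ (univ.filter (fun b : PBond P i' => blockOf b.src = x ∨ blockOf b.src = x.shift μ ∨ blockOf b.src = x.shift ν ∨ blockOf b.src = (x.shift μ).shift ν)), ‖X i' b‖ ^ 2)))) / a₀ ^ 2 + ((((P.d + 2) * P.L : ℕ) : ℝ) * (max 0 (min (Mb i') (Real.sqrt (∑ b ∈ (univ.filter (fun b : PBond P i' => blockOf b.src = x ∨ blockOf b.src = x.shift μ ∨ blockOf b.src = x.shift ν ∨ blockOf b.src = (x.shift μ).shift ν)), ‖X i' b‖ ^ 2))))) ^ 3 + 8 * (67 * ((((P.d + 2) * P.L : ℕ) : ℝ) * (((P.d - 1 : ℕ) : ℝ) * ((3 * P.L : ℕ) : ℝ) * (max 0 (δ (i' + 1)))))) * (max 0 (min (Mb i') (Real.sqrt (∑ b ∈ (univ.filter (fun b : PBond P i' => blockOf b.src = x ∨ blockOf b.src = x.shift μ ∨ blockOf b.src = x.shift ν ∨ blockOf b.src = (x.shift μ).shift ν)), ‖X i' b‖ ^ 2)))) ^ 2 / a₀ ^ 2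
      have hM : (0 : ℝ) ≤ (max 0 (min (Mb i') (Real.sqrt (∑ b ∈ (univ.filter (fun b : PBond P i' => blockOf b.src = x ∨ blockOf b.src = x.shift μ ∨ blockOf b.src = x.shift ν ∨ blockOf b.src = (x.shift μ).shift ν)), ‖X i' b‖ ^ 2)))) := le_max_left _ _
      have hO : (0 : ℝ) ≤ (max 0 (min (Olev (i' + 1)) (2 * (max 0 (min (Mb i') (Real.sqrt (∑ b ∈ (univ.filter (fun b : PBond P i' => blockOf b.src = x ∨ blockOf b.src = x.shift μ ∨ blockOf b.src = x.shift ν ∨ blockOf b.src = (x.shift μ).shift ν)), ‖X i' b‖ ^ 2))))))) := le_max_left _ _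
      have hD : (0 : ℝ) ≤ (max 0 (δ (i' + 1))) := le_max_left _ _
      positivity
  · -- (hR) C₇a at the clamped local letters
    intro μ ν hμν i hi y' c hc
    have hj : i + 1 ≤ P.m + P.K := by omega
    have hMb0' := hMb0 i hi
    have hMcMb : (max 0 (min (Mb i) (Real.sqrt (∑ b ∈ (univ.filter (fun b : PBond P i => blockOf b.src = y' ∨ blockOf b.src = y'.shift μ ∨ blockOf b.src = y'.shift ν ∨ blockOf b.src = (y'.shift μ).shift ν)), ‖X i b‖ ^ 2)))) ≤ Mb i := max_le hMb0' (min_le_left _ _)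
    have hMc0 : (0 : ℝ) ≤ (max 0 (min (Mb i) (Real.sqrt (∑ b ∈ (univ.filter (fun b : PBond P i => blockOf b.src = y' ∨ blockOf b.src = y'.shift μ ∨ blockOf b.src = y'.shift ν ∨ blockOf b.src = (y'.shift μ).shift ν)), ‖X i b‖ ^ 2)))) := le_max_left _ _
    have hXM : ∀ b : PBond P i, (blockOf b.src = y' ∨ blockOf b.src = y'.shift μ ∨ blockOf b.src = y'.shift ν ∨ blockOf b.src = (y'.shift μ).shift ν) → ‖X i b‖ ≤ (max 0 (min (Mb i) (Real.sqrt (∑ b ∈ (univ.filter (fun b : PBond P i => blockOf b.src = y' ∨ blockOf b.src = y'.shift μ ∨ blockOf b.src = y'.shift ν ∨ blockOf b.src = (y'.shift μ).shift ν)), ‖X i b‖ ^ 2)))) := fun b hb =>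
      le_max_of_le_right (le_min (hMb i hi b) (le_sqrt_sum_sq_of_mem (fun b => ‖X i b‖) (fun _ => norm_nonneg _) (Finset.mem_filter.2 ⟨Finset.mem_univ _, hb⟩)))
    have hcorner0 : ∀ κ : Fin P.d, blockOf ((⟨emb y', κ⟩ : PBond P i)).src = y' ∨ blockOf ((⟨emb y', κ⟩ : PBond P i)).src = y'.shift μ ∨
        blockOf ((⟨emb y', κ⟩ : PBond P i)).src = y'.shift ν ∨ blockOf ((⟨emb y', κ⟩ : PBond P i)).src = (y'.shift μ).shift ν :=
      fun κ => Or.inl (Site.blockOf_emb hj y')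
    have hAM : ‖(fun κ : Fin P.d => (⟨(((T4AxialGaugeSmallField.axialGauge (U i) (fun κ : Fin P.d => (((emb y' κ).val : ℕ) : ℤ) - (((P.L - 1) / 2 : ℕ) : ℤ)) (fun κ : Fin P.d => (((emb y' κ).val : ℕ) : ℤ) + (((if κ = μ then (P.L : ℤ) else 0) + (if κ = ν then (P.L : ℤ) else 0)) + (((P.L - 1) / 2 : ℕ) : ℤ)) + 1)) (⟨emb y', κ⟩ : PBond P i).src : SU N) : Matrix (Fin N) (Fin N) ℂ) * ((X i (⟨emb y', κ⟩ : PBond P i) : (specialUnitaryLogChart (Fin N)).lie) : Matrix (Fin N) (Fin N) ℂ) * star (((T4AxialGaugeSmallField.axialGauge (U i) (fun κ : Fin P.d => (((emb y' κ).val : ℕ) : ℤ) - (((P.L - 1) / 2 : ℕ) : ℤ)) (fun κ : Fin P.d => (((emb y' κ).val : ℕ) : ℤ) + (((if κ = μ then (P.L : ℤ) else 0) + (if κ = ν then (P.L : ℤ) else 0)) + (((P.L - 1) / 2 : ℕ) : ℤ)) + 1)) (⟨emb y', κ⟩ : PBond P i).src : SU N) : Matrix (Fin N) (Fin N) ℂ),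 conj_mem_lie _ _⟩ : (specialUnitaryLogChart (Fin N)).lie))‖ ≤ (max 0 (min (Mb i) (Real.sqrt (∑ b ∈ (univ.filter (fun b : PBond P i => blockOf b.src = y' ∨ blockOf b.src = y'.shift μ ∨ blockOf b.src = y'.shift ν ∨ blockOf b.src = (y'.shift μ).shift ν)), ‖X i b‖ ^ 2)))) := by
      refine (pi_norm_le_iff_of_nonneg hMc0).2 fun κ => ?_
      rw [← Submodule.norm_coe]
      exact (norm_coe_conj_le _ _).trans (by rw [Submodule.norm_coe]; exact hXM _ (hcorner0 κ))
    have hMa : 8 * (max 0 (min (Mb i) (Real.sqrt (∑ b ∈ (univ.filter (fun b : PBond P i => blockOf b.src = y' ∨ blockOf b.src = y'.shift μ ∨ blockOf b.src = y'.shift ν ∨ blockOf b.src = (y'.shift μ).shift ν)), ‖X i b‖ ^ 2)))) ≤ a₀ := by linarith [hMb16 i hi]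
    have hOc0 : (0 : ℝ) ≤ (max 0 (min (Olev (i + 1)) (2 * (max 0 (min (Mb i) (Real.sqrt (∑ b ∈ (univ.filter (fun b : PBond P i => blockOf b.src = y' ∨ blockOf b.src = y'.shift μ ∨ blockOf b.src = y'.shift ν ∨ blockOf b.src = (y'.shift μ).shift ν)), ‖X i b‖ ^ 2))))))) := le_max_left _ _
    have hOc2 : (max 0 (min (Olev (i + 1)) (2 * (max 0 (min (Mb i) (Real.sqrt (∑ b ∈ (univ.filter (fun b : PBond P i => blockOf b.src = y' ∨ blockOf b.src = y'.shift μ ∨ blockOf b.src = y'.shift ν ∨ blockOf b.src = (y'.shift μ).shift ν)), ‖X i b‖ ^ 2))))))) ≤ 2 * (max 0 (min (Mb i) (Real.sqrt (∑ b ∈ (univ.filter (fun b : PBond P i => blockOf b.src = y' ∨ blockOf b.src = y'.shift μ ∨ blockOf b.src = y'.shift ν ∨ blockOf b.src = (y'.shift μ).shift ν)), ‖X i b‖ ^ 2)))) := max_le (by linarith) (min_le_right _ _)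
    have hOa : 8 * (max 0 (min (Olev (i + 1)) (2 * (max 0 (min (Mb i) (Real.sqrt (∑ b ∈ (univ.filter (fun b : PBond P i => blockOf b.src = y' ∨ blockOf b.src = y'.shift μ ∨ blockOf b.src = y'.shift ν ∨ blockOf b.src = (y'.shift μ).shift ν)), ‖X i b‖ ^ 2))))))) ≤ a₀ := by linarith [hMb16 i hi]
    have hXO : ∀ b : PBond P i, (blockOf b.src = y' ∨ blockOf b.src = y'.shift μ ∨ blockOf b.src = y'.shift ν ∨ blockOf b.src = (y'.shift μ).shift ν) →
        ‖(((T4AxialGaugeSmallField.axialGauge (U i) (fun κ : Fin P.d => (((emb y' κ).val : ℕ) : ℤ) - (((P.L - 1) / 2 : ℕ) : ℤ)) (fun κ : Fin P.d => (((emb y' κ).val : ℕ) : ℤ) + (((if κ = μ then (P.L : ℤ) else 0) + (if κ = ν then (P.L : ℤ) else 0)) + (((P.L - 1) / 2 : ℕ) : ℤ)) + 1)) b.src : SU N) : Matrix (Fin N) (Fin N) ℂ) * ((X i b : (specialUnitaryLogChart (Fin N)).lie) : Matrix (Fin N) (Fin N) ℂ) * star (((T4AxialGaugeSmallField.axialGauge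 (U i) (fun κ : Fin P.d => (((emb y' κ).val : ℕ) : ℤ) - (((P.L - 1) / 2 : ℕ) : ℤ)) (fun κ : Fin P.d => (((emb y' κ).val : ℕ) : ℤ) + (((if κ = μ then (P.L : ℤ) else 0) + (if κ = ν then (P.L : ℤ) else 0)) + (((P.L - 1) / 2 : ℕ) : ℤ)) + 1)) b.src : SU N) : Matrix (Fin N) (Fin N) ℂ) - (((fun κ : Fin P.d => (⟨(((T4AxialGaugeSmallField.axialGauge (U i) (fun κ : Fin P.d => (((emb y' κ).val : ℕ) : ℤ) - (((P.L - 1) / 2 : ℕ) : ℤ)) (fun κ : Fin P.d => (((emb y' κ).val : ℕ) : ℤ) + (((if κ = μ then (P.L : ℤ) else 0) + (if κ = ν then (P.L : ℤ) else 0)) + (((P.L - 1) / 2 : ℕ) : ℤ)) + 1)) (⟨emb y', κ⟩ : PBond P i).src : SU N) : Matrix (Fin N) (Fin N) ℂ) * ((X i (⟨emb y', κ⟩ : PBond P i) : (specialUnitaryLogChart (Fin N)).lie) : Matrix (Fin N) (Fin N) ℂ) * star (((T4AxialGaugeSmallField.axialGauge (U i) (fun κ : Fin P.d => (((emb y' κ).val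 : ℕ) : ℤ) - (((P.L - 1) / 2 : ℕ) : ℤ)) (fun κ : Fin P.d => (((emb y' κ).val : ℕ) : ℤ) + (((if κ = μ then (P.L : ℤ) else 0) + (if κ = ν then (P.L : ℤ) else 0)) + (((P.L - 1) / 2 : ℕ) : ℤ)) + 1)) (⟨emb y', κ⟩ : PBond P i).src : SU N) : Matrix (Fin N) (Fin N) ℂ), conj_mem_lie _ _⟩ : (specialUnitaryLogChart (Fin N)).lie)) b.dir : (specialUnitaryLogChart (Fin N)).lie) : Matrix (Fin N) (Fin N) ℂ)‖ ≤ (max 0 (min (Olev (i + 1)) (2 * (max 0 (min (Mb i) (Real.sqrt (∑ b ∈ (univ.filter (fun b : PBond P i => blockOf b.src = y' ∨ blockOf b.src = y'.shift μ ∨ blockOf b.src = y'.shift ν ∨ blockOf b.src = (y'.shift μ).shift ν)), ‖X i b‖ ^ 2))))))) := by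
      intro b hb
      refine le_max_of_le_right (le_min ?_ ?_)
      · exact hOSC μ ν hμν i hi y' b ⟨emb y', b.dir⟩ hb (hcorner0 b.dir) rfl
      · calc _ ≤ ‖(((T4AxialGaugeSmallField.axialGauge (U i) (fun κ : Fin P.d => (((emb y' κ).val : ℕ) : ℤ) - (((P.L - 1) / 2 : ℕ) : ℤ)) (fun κ : Fin P.d => (((emb y' κ).val : ℕ) : ℤ) + (((if κ = μ then (P.L : ℤ) else 0) + (if κ = ν then (P.L : ℤ) else 0)) + (((P.L - 1) / 2 : ℕ) : ℤ)) + 1)) b.src : SU N) : Matrix (Fin N) (Fin N) ℂ) * ((X i b : (specialUnitaryLogChart (Fin N)).lie) : Matrix (Fin N) (Fin N) ℂ) * star (((T4AxialGaugeSmallField.axialGauge (U i) (fun κ : Fin P.d => (((emb y' κ).val : ℕ) : ℤ) - (((P.L - 1) / 2 : ℕ) : ℤ)) (fun κ : Fin P.d => (((emb y' κ).val : ℕ) : ℤ) + (((if κ = μ then (P.L : ℤ) else 0) + (if κ = ν then (P.L : ℤ) else 0)) + (((P.L - 1) / 2 : ℕ) : ℤ)) + 1)) b.src : SU N) : Matrix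 (Fin N) (Fin N) ℂ)‖ + ‖(((fun κ : Fin P.d => (⟨(((T4AxialGaugeSmallField.axialGauge (U i) (fun κ : Fin P.d => (((emb y' κ).val : ℕ) : ℤ) - (((P.L - 1) / 2 : ℕ) : ℤ)) (fun κ : Fin P.d => (((emb y' κ).val : ℕ) : ℤ) + (((if κ = μ then (P.L : ℤ) else 0) + (if κ = ν then (P.L : ℤ) else 0)) + (((P.L - 1) / 2 : ℕ) : ℤ)) + 1)) (⟨emb y', κ⟩ : PBond P i).src : SU N) : Matrix (Fin N) (Fin N) ℂ) * ((X i (⟨emb y', κ⟩ : PBond P i) : (specialUnitaryLogChart (Fin N)).lie) : Matrix (Fin N) (Fin N) ℂ) * star (((T4AxialGaugeSmallField.axialGauge (U i) (fun κ : Fin P.d => (((emb y' κ).val : ℕ) : ℤ) - (((P.L - 1) / 2 : ℕ) : ℤ)) (fun κ : Fin P.d => (((emb y' κ).val : ℕ) : ℤ) + (((if κ = μ then (P.L : ℤ) else 0) + (if κ = ν then (P.L : ℤ) else 0)) + (((P.L - 1) / 2 : ℕ) : ℤ)) + 1)) (⟨emb y', κ⟩ : PBond P i).src : SU N) : Matrix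 (Fin N) (Fin N) ℂ), conj_mem_lie _ _⟩ : (specialUnitaryLogChart (Fin N)).lie)) b.dir : (specialUnitaryLogChart (Fin N)).lie) : Matrix (Fin N) (Fin N) ℂ)‖ := norm_sub_le _ _
          _ ≤ (max 0 (min (Mb i) (Real.sqrt (∑ b ∈ (univ.filter (fun b : PBond P i => blockOf b.src = y' ∨ blockOf b.src = y'.shift μ ∨ blockOf b.src = y'.shift ν ∨ blockOf b.src = (y'.shift μ).shift ν)), ‖X i b‖ ^ 2)))) + (max 0 (min (Mb i) (Real.sqrt (∑ b ∈ (univ.filter (fun b : PBond P i => blockOf b.src = y' ∨ blockOf b.src = y'.shift μ ∨ blockOf b.src = y'.shift ν ∨ blockOf b.src = (y'.shift μ).shift ν)), ‖X i b‖ ^ 2)))) := by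
              refine add_le_add ((norm_coe_conj_le _ _).trans ?_) ((norm_coe_conj_le _ _).trans ?_)
              · rw [Submodule.norm_coe]; exact hXM b hb
              · rw [Submodule.norm_coe]; exact hXM _ (hcorner0 b.dir)
          _ = 2 * (max 0 (min (Mb i) (Real.sqrt (∑ b ∈ (univ.filter (fun b : PBond P i => blockOf b.src = y' ∨ blockOf b.src = y'.shift μ ∨ blockOf b.src = y'.shift ν ∨ blockOf b.src = (y'.shift μ).shift ν)), ‖X i b‖ ^ 2)))) := by ring
    have hδc0 : (0 : ℝ) ≤ (max 0 (δ (i + 1))) := le_max_left _ _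
    have hUsc : PlaqSmall (max 0 (δ (i + 1))) (U i) := fun p => lt_of_lt_of_le (hUs i hi p) (le_max_right _ _)
    have hδℓc : 100 * ((((P.d + 2) * P.L : ℕ) : ℝ) * (((P.d - 1 : ℕ) : ℝ) * ((3 * P.L : ℕ) : ℝ) * (max 0 (δ (i + 1))))) ≤ ρr := by
      rw [max_eq_right (hδ i hi)]; exact hδℓ i hi
    exact norm_remainder_le_on_four_cov (by omega) (U i) hρ0 hρr (hα i hi) (hα4 i hi) hδc0 hUsc hδℓc ha0 ha
      (X i) y' (fun κ : Fin P.d => (⟨(((T4AxialGaugeSmallField.axialGauge (U i) (fun κ : Fin P.d => (((emb y' κ).val : ℕ) : ℤ) - (((P.L - 1) / 2 : ℕ) : ℤ)) (fun κ : Fin P.d => (((emb y' κ).val : ℕ) : ℤ) + (((if κ = μ then (P.L : ℤ) else 0) + (if κ = ν then (P.L : ℤ) else 0)) + (((P.L - 1) / 2 : ℕ) : ℤ)) + 1)) (⟨emb y', κ⟩ : PBond P i).src : SU N) : Matrix (Fin N) (Fin N) ℂ) * ((X i (⟨emb y', κ⟩ : PBond P i) : (specialUnitaryLogChart (Fin N)).lie)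 : Matrix (Fin N) (Fin N) ℂ) * star (((T4AxialGaugeSmallField.axialGauge (U i) (fun κ : Fin P.d => (((emb y' κ).val : ℕ) : ℤ) - (((P.L - 1) / 2 : ℕ) : ℤ)) (fun κ : Fin P.d => (((emb y' κ).val : ℕ) : ℤ) + (((if κ = μ then (P.L : ℤ) else 0) + (if κ = ν then (P.L : ℤ) else 0)) + (((P.L - 1) / 2 : ℕ) : ℤ)) + 1)) (⟨emb y', κ⟩ : PBond P i).src : SU N) : Matrix (Fin N) (Fin N) ℂ), conj_mem_lie _ _⟩ : (specialUnitaryLogChart (Fin N)).lie)) hOc0 hAM hMa hOa hXM hXO c hc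
  · -- (hRa) the class bound, squared against the ℓ²-corner size
    intro μ ν i hi y'
    have hMb0' := hMb0 i hi
    have hMc : (max 0 (min (Mb i) (Real.sqrt (∑ b ∈ (univ.filter (fun b : PBond P i => blockOf b.src = y' ∨ blockOf b.src = y'.shift μ ∨ blockOf b.src = y'.shift ν ∨ blockOf b.src = (y'.shift μ).shift ν)), ‖X i b‖ ^ 2)))) ≤ Mb i := max_le hMb0' (min_le_left _ _)
    have hMc0 : (0 : ℝ) ≤ (max 0 (min (Mb i) (Real.sqrt (∑ b ∈ (univ.filter (fun b : PBond P i => blockOf b.src = y' ∨ blockOf b.src = y'.shift μ ∨ blockOf b.src = y'.shift ν ∨ blockOf b.src = (y'.shift μ).shift ν)), ‖X i b‖ ^ 2)))) := le_max_left _ _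
    have hMcM2 : (max 0 (min (Mb i) (Real.sqrt (∑ b ∈ (univ.filter (fun b : PBond P i => blockOf b.src = y' ∨ blockOf b.src = y'.shift μ ∨ blockOf b.src = y'.shift ν ∨ blockOf b.src = (y'.shift μ).shift ν)), ‖X i b‖ ^ 2)))) ≤ Real.sqrt (∑ b ∈ (univ.filter (fun b : PBond P i => blockOf b.src = y' ∨ blockOf b.src = y'.shift μ ∨ blockOf b.src = y'.shift ν ∨ blockOf b.src = (y'.shift μ).shift ν)), ‖X i b‖ ^ 2) := max_le (Real.sqrt_nonneg _) (min_le_right _ _)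
    have hOc0 : (0 : ℝ) ≤ (max 0 (min (Olev (i + 1)) (2 * (max 0 (min (Mb i) (Real.sqrt (∑ b ∈ (univ.filter (fun b : PBond P i => blockOf b.src = y' ∨ blockOf b.src = y'.shift μ ∨ blockOf b.src = y'.shift ν ∨ blockOf b.src = (y'.shift μ).shift ν)), ‖X i b‖ ^ 2))))))) := le_max_left _ _
    have hOcO : (max 0 (min (Olev (i + 1)) (2 * (max 0 (min (Mb i) (Real.sqrt (∑ b ∈ (univ.filter (fun b : PBond P i => blockOf b.src = y' ∨ blockOf b.src = y'.shift μ ∨ blockOf b.src = y'.shift ν ∨ blockOf b.src = (y'.shift μ).shift ν)), ‖X i b‖ ^ 2))))))) ≤ Olev (i + 1) := max_le (hO0 i hi) (min_le_left _ _)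
    have hOc2 : (max 0 (min (Olev (i + 1)) (2 * (max 0 (min (Mb i) (Real.sqrt (∑ b ∈ (univ.filter (fun b : PBond P i => blockOf b.src = y' ∨ blockOf b.src = y'.shift μ ∨ blockOf b.src = y'.shift ν ∨ blockOf b.src = (y'.shift μ).shift ν)), ‖X i b‖ ^ 2))))))) ≤ 2 * (max 0 (min (Mb i) (Real.sqrt (∑ b ∈ (univ.filter (fun b : PBond P i => blockOf b.src = y' ∨ blockOf b.src = y'.shift μ ∨ blockOf b.src = y'.shift ν ∨ blockOf b.src = (y'.shift μ).shift ν)), ‖X i b‖ ^ 2)))) := max_le (by linarith) (min_le_right _ _)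
    have hδc : (max 0 (δ (i + 1))) = δ (i + 1) := max_eq_right (hδ i hi)
    have hD : (0 : ℝ) ≤ ((P.d - 1 : ℕ) : ℝ) * ((3 * P.L : ℕ) : ℝ) := by positivity
    have hmain := rprime_le_class_mul (ℓ := (((P.d + 2) * P.L : ℕ) : ℝ)) (D := ((P.d - 1 : ℕ) : ℝ) * ((3 * P.L : ℕ) : ℝ)) hB0 (Nat.cast_nonneg _) hD ha0
      hMc0 hMc (hMb16 i hi) (hδ i hi) hOc0 hOcO hOc2
    have hR0 : (0 : ℝ) ≤ 8 * (54 * ((((P.d + 2) * P.L : ℕ) : ℝ) * (Real.exp a₀ - 1))) * (max 0 (min (Olev (i + 1)) (2 * (max 0 (min (Mb i) (Real.sqrt (∑ b ∈ (univ.filter (fun b : PBond P i => blockOf b.src = y' ∨ blockOf b.src = y'.shift μ ∨ blockOf b.src = y'.shift ν ∨ blockOf b.src = (y'.shift μ).shift ν)), ‖X i b‖ ^ 2))))))) ^ 2 / (a₀ - (max 0 (min (Mb i) (Real.sqrt (∑ b ∈ (univ.filter (fun b : PBond P i => blockOf b.src = y' ∨ blockOf b.src = y'.shift μ ∨ blockOf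 b.src = y'.shift ν ∨ blockOf b.src = (y'.shift μ).shift ν)), ‖X i b‖ ^ 2))))) ^ 2 + 32 * (54 * ((((P.d + 2) * P.L : ℕ) : ℝ) * (Real.exp a₀ - 1))) * (max 0 (min (Olev (i + 1)) (2 * (max 0 (min (Mb i) (Real.sqrt (∑ b ∈ (univ.filter (fun b : PBond P i => blockOf b.src = y' ∨ blockOf b.src = y'.shift μ ∨ blockOf b.src = y'.shift ν ∨ blockOf b.src = (y'.shift μ).shift ν)), ‖X i b‖ ^ 2))))))) * (max 0 (min (Mb i) (Real.sqrt (∑ b ∈ (univ.filter (fun b : PBond P i => blockOf b.src = y' ∨ blockOf b.src = y'.shift μ ∨ blockOf b.src = y'.shift ν ∨ blockOf b.src = (y'.shift μ).shift ν)), ‖X i b‖ ^ 2)))) / a₀ ^ 2 +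
        ((((P.d + 2) * P.L : ℕ) : ℝ) * (max 0 (min (Mb i) (Real.sqrt (∑ b ∈ (univ.filter (fun b : PBond P i => blockOf b.src = y' ∨ blockOf b.src = y'.shift μ ∨ blockOf b.src = y'.shift ν ∨ blockOf b.src = (y'.shift μ).shift ν)), ‖X i b‖ ^ 2))))) ^ 3 + 8 * (67 * ((((P.d + 2) * P.L : ℕ) : ℝ) * (((P.d - 1 : ℕ) : ℝ) * ((3 * P.L : ℕ) : ℝ) * δ (i + 1)))) * (max 0 (min (Mb i) (Real.sqrt (∑ b ∈ (univ.filter (fun b : PBond P i => blockOf b.src = y' ∨ blockOf b.src = y'.shift μ ∨ blockOf b.src = y'.shift ν ∨ blockOf b.src = (y'.shift μ).shift ν)), ‖X i b‖ ^ 2)))) ^ 2 / a₀ ^ 2 := by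
      have := hδ i hi
      positivity
    have hsq : Real.sqrt (∑ b ∈ (univ.filter (fun b : PBond P i => blockOf b.src = y' ∨ blockOf b.src = y'.shift μ ∨ blockOf b.src = y'.shift ν ∨ blockOf b.src = (y'.shift μ).shift ν)), ‖X i b‖ ^ 2) ^ 2 = ∑ b ∈ (univ.filter (fun b : PBond P i => blockOf b.src = y' ∨ blockOf b.src = y'.shift μ ∨ blockOf b.src = y'.shift ν ∨ blockOf b.src = (y'.shift μ).shift ν)), ‖X i b‖ ^ 2 := Real.sq_sqrt (Finset.sum_nonneg fun _ _ => sq_nonneg _)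
    have hM2sq : (max 0 (min (Mb i) (Real.sqrt (∑ b ∈ (univ.filter (fun b : PBond P i => blockOf b.src = y' ∨ blockOf b.src = y'.shift μ ∨ blockOf b.src = y'.shift ν ∨ blockOf b.src = (y'.shift μ).shift ν)), ‖X i b‖ ^ 2)))) ^ 2 ≤ ∑ b ∈ (univ.filter (fun b : PBond P i => blockOf b.src = y' ∨ blockOf b.src = y'.shift μ ∨ blockOf b.src = y'.shift ν ∨ blockOf b.src = (y'.shift μ).shift ν)), ‖X i b‖ ^ 2 :=
      calc _ ≤ Real.sqrt (∑ b ∈ (univ.filter (fun b : PBond P i => blockOf b.src = y' ∨ blockOf b.src = y'.shift μ ∨ blockOf b.src = y'.shift ν ∨ blockOf b.src = (y'.shift μ).shift ν)), ‖X i b‖ ^ 2) ^ 2 := pow_le_pow_left₀ hMc0 hMcM2 2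
        _ = _ := hsq
    show (8 * (54 * ((((P.d + 2) * P.L : ℕ) : ℝ) * (Real.exp a₀ - 1))) * (max 0 (min (Olev (i + 1)) (2 * (max 0 (min (Mb i) (Real.sqrt (∑ b ∈ (univ.filter (fun b : PBond P i => blockOf b.src = y' ∨ blockOf b.src = y'.shift μ ∨ blockOf b.src = y'.shift ν ∨ blockOf b.src = (y'.shift μ).shift ν)), ‖X i b‖ ^ 2))))))) ^ 2 / (a₀ - (max 0 (min (Mb i) (Real.sqrt (∑ b ∈ (univ.filter (fun b : PBond P i => blockOf b.src = y' ∨ blockOf b.src = y'.shift μ ∨ blockOf b.src = y'.shift ν ∨ blockOf b.src = (y'.shift μ).shift ν)), ‖X i b‖ ^ 2))))) ^ 2 + 32 * (54 * ((((P.d + 2) * P.L : ℕ) : ℝ) * (Real.exp a₀ - 1))) * (max 0 (min (Olev (i + 1)) (2 * (max 0 (min (Mb i) (Real.sqrt (∑ b ∈ (univ.filter (fun b : PBond P i => blockOf b.src = y' ∨ blockOf b.src = y'.shift μ ∨ blockOf b.src = y'.shift ν ∨ blockOf b.src = (y'.shift μ).shift ν)), ‖X i b‖ ^ 2))))))) *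 (max 0 (min (Mb i) (Real.sqrt (∑ b ∈ (univ.filter (fun b : PBond P i => blockOf b.src = y' ∨ blockOf b.src = y'.shift μ ∨ blockOf b.src = y'.shift ν ∨ blockOf b.src = (y'.shift μ).shift ν)), ‖X i b‖ ^ 2)))) / a₀ ^ 2 + ((((P.d + 2) * P.L : ℕ) : ℝ) * (max 0 (min (Mb i) (Real.sqrt (∑ b ∈ (univ.filter (fun b : PBond P i => blockOf b.src = y' ∨ blockOf b.src = y'.shift μ ∨ blockOf b.src = y'.shift ν ∨ blockOf b.src = (y'.shift μ).shift ν)), ‖X i b‖ ^ 2))))) ^ 3 + 8 * (67 * ((((P.d + 2) * P.L : ℕ) : ℝ) * (((P.d - 1 : ℕ) : ℝ) * ((3 * P.L : ℕ) : ℝ) * (max 0 (δ (i + 1)))))) * (max 0 (min (Mb i) (Real.sqrt (∑ b ∈ (univ.filter (fun b : PBond P i => blockOf b.src = y' ∨ blockOf b.src = y'.shift μ ∨ blockOf b.src = y'.shift ν ∨ blockOf b.src = (y'.shift μ).shift ν)), ‖X i b‖ ^ 2)))) ^ 2 / a₀ ^ 2) ^ 2 ≤ (16 * (54 * ((((P.d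 + 2) * P.L : ℕ) : ℝ) * (Real.exp a₀ - 1))) * Olev (i + 1) / (a₀ - Mb i) ^ 2 + 32 * (54 * ((((P.d + 2) * P.L : ℕ) : ℝ) * (Real.exp a₀ - 1))) * Olev (i + 1) / a₀ ^ 2 +
          (((P.d + 2) * P.L : ℕ) : ℝ) ^ 3 * (Mb i) ^ 2 + 8 * (67 * ((((P.d + 2) * P.L : ℕ) : ℝ) * (((P.d - 1 : ℕ) : ℝ) * ((3 * P.L : ℕ) : ℝ) * δ (i + 1)))) * Mb i / a₀ ^ 2) ^ 2 * ∑ b ∈ (univ.filter (fun b : PBond P i => blockOf b.src = y' ∨ blockOf b.src = y'.shift μ ∨ blockOf b.src = y'.shift ν ∨ blockOf b.src = (y'.shift μ).shift ν)), ‖X i b‖ ^ 2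
    rw [hδc]
    calc _ ≤ ((16 * (54 * ((((P.d + 2) * P.L : ℕ) : ℝ) * (Real.exp a₀ - 1))) * Olev (i + 1) / (a₀ - Mb i) ^ 2 + 32 * (54 * ((((P.d + 2) * P.L : ℕ) : ℝ) * (Real.exp a₀ - 1))) * Olev (i + 1) / a₀ ^ 2 +
          (((P.d + 2) * P.L : ℕ) : ℝ) ^ 3 * (Mb i) ^ 2 + 8 * (67 * ((((P.d + 2) * P.L : ℕ) : ℝ) * (((P.d - 1 : ℕ) : ℝ) * ((3 * P.L : ℕ) : ℝ) * δ (i + 1)))) * Mb i / a₀ ^ 2) * (max 0 (min (Mb i) (Real.sqrt (∑ b ∈ (univ.filter (fun b : PBond P i => blockOf b.src = y' ∨ blockOf b.src = y'.shift μ ∨ blockOf b.src = y'.shift ν ∨ blockOf b.src = (y'.shift μ).shift ν)), ‖X i b‖ ^ 2))))) ^ 2 := pow_le_pow_left₀ hR0 hmain 2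
      _ = (16 * (54 * ((((P.d + 2) * P.L : ℕ) : ℝ) * (Real.exp a₀ - 1))) * Olev (i + 1) / (a₀ - Mb i) ^ 2 + 32 * (54 * ((((P.d + 2) * P.L : ℕ) : ℝ) * (Real.exp a₀ - 1))) * Olev (i + 1) / a₀ ^ 2 +
          (((P.d + 2) * P.L : ℕ) : ℝ) ^ 3 * (Mb i) ^ 2 + 8 * (67 * ((((P.d + 2) * P.L : ℕ) : ℝ) * (((P.d - 1 : ℕ) : ℝ) * ((3 * P.L : ℕ) : ℝ) * δ (i + 1)))) * Mb i / a₀ ^ 2) ^ 2 * (max 0 (min (Mb i) (Real.sqrt (∑ b ∈ (univ.filter (fun b : PBond P i => blockOf b.src = y' ∨ blockOf b.src = y'.shift μ ∨ blockOf b.src = y'.shift ν ∨ blockOf b.src = (y'.shift μ).shift ν)), ‖X i b‖ ^ 2)))) ^ 2 := mul_pow _ _ _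
      _ ≤ _ := mul_le_mul_of_nonneg_left hM2sq (sq_nonneg _)

end Summit.QuantumFields.YangMills.Theorems.FluctuationComparisonRegPrIntLS2BetaRemainderRowClass

end
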